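import Mathlib
import Summits.Ventures.FusionMHD.Models.CerfonFreidbergIterLikeQHalfObligation
import HarnessLib

/-!
# Ventures/FusionMHD — Models/CerfonFreidbergIterLikeQHalfPanels1.lean: KERNEL CHECK of panels 0, 1, 2 (of 32) of the
# certified interior safety factor `q(ψ_N = 1/2)/F` of THE Cerfon–Freidberg ITER-like instance

HONEST FRAMING (LADDER-GRIDFUSION three columns; CF rung, F2 item R2).  One `decide +kernel` (≈ 116 s on the farm): for each panel `j` listed,
the per-panel obligation `QHalf.PanelCert.ok` (`Models/CerfonFreidbergIterLikeQHalfObligation.lean`) — the Taylor-model run of `QHalf.progG`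
(`Models/CerfonFreidbergIterLikeQHalfDefs.lean`) over the parameter box is ACCEPTED (every `log`/`sin`/`cos` composition and the `inv`
certificate), and the kernel's panel-integral enclosure of the polar `(6.35)` integrand along the approximant, the range of the flux residual
`U(ray m) − U_a/2`, the range of the approximant `m` and the range of the radial derivative `D_r(θ, m)` lie inside the integers claimed in
`panelCert1` (values read off a compiled `#eval` of the same functions, slack one unit of `2⁻⁶⁰`).  What these Booleans MEAN (real-number
statements, uniformly over the parameter box ∋ THE instance) is proved once in `Models/CerfonFreidbergIterLikeQHalfSound.lean`; the
assembly is `Models/CerfonFreidbergIterLikeQHalf.lean`.  MODELLED: analytic Cerfon–Freidberg family; `q` of a MODEL surface — nothing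
about a device or stability.  No `native_decide`.  Typer/prover: gridfusion-model-5 (g7), 2026-08-27.
Citations: Freidberg 2014 §6.3.5 (6.35) [Freidberg2014]; Mahboubi–Melquiond–Sibut-Pinote 2016 §3.2 Lemma 3 [MahboubiMelquiondSibutpinote2016].
-/

namespace Summit.Ventures.FusionMHD.Models.CFIterLike.QHalf

/-- The certificate data of panels 0, 1, 2: `inv` candidate (degree-8 fit of `(X·D_r)⁻¹` in the panel variable, scaled by `2⁶⁰`), Taylor
degree, `inv` widening `2^elog2`, and the claimed integral / residual / `m`-range / `D_r`-range integers (× `2⁶⁰`). [instance data] -/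
def panelCert1 : List PanelCert := [
  { j := 0, cand := [4657821673767238656, 352009464959731904, 11287382385824294912, 1478944466408648448, 23811769605960278016, 5717296445024062464, 61290361783373045760, 18982369658719797248, 636672030246079823872],
    deg := 12, elog2 := 36, plo := 91475368440301415, phi := 91475371849110074, eta := 602743946, mlo := 230119348978684963, mhi := 230961518658716637,
    dlo := 228847571903278841, dhi := 229527721475032260 },
  { j := 1, cand := [4679912874712158208, 1064748831843999744, 11568195264110346240, 4549628323972522496, 25634472633635614720, 17846281998662072320, 69054257085196288000, 53523567200747986944, 182289328568421056512],
    deg := 12, elog2 := 35, plo := 92358424491991325, phi := 92358426187840678, eta := 291747040, mlo := 230676703855117697, mhi := 232653217534554692,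
    dlo := 227489552726225913, dhi := 229073505177201525 },
  { j := 2, cand := [4724647229839461376, 1804317062226366720, 12151396283710590976, 7972391945366727680, 29501305419544117248, 32143655987454230528, 85007014302328602624, 94164456207144697856, 69034354460695175168],
    deg := 10, elog2 := 35, plo := 94154627890512741, phi := 94154629611311080, eta := 293699773, mlo := 232360552346751208, mhi := 235498893034407824,
    dlo := 225233185635650351, dhi := 227713793405294173 }]

/-- **KERNEL CHECK** of panels 0, 1, 2. -/
theorem panelCert1_ok : panelCert1.all PanelCert.ok = true := by
  decide +kernel

end Summit.Ventures.FusionMHD.Models.CFIterLike.QHalf
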